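import Summits.CriticalPhenomena.PercolationContinuityZ3.Theses.PercAntiMeanFieldOnset
import Summits.CriticalPhenomena.PercolationContinuityZ3.Theorems.PercNearOneGluingNoHeavyQuantThetaPivotalPerimeter
import Literature.Probability.Percolation.MagnetizationLowerBound
import Literature.Probability.Percolation.HutchcroftVolumeTail
import Literature.Probability.Percolation.FiniteEnergy
import Literature.Probability.Percolation.PercolationProofs
import Literature.Probability.Percolation.SharpnessDCTProofs
import Literature.Probability.Percolation.RSW
import HarnessLib

/-!
# `PercAntiMeanFieldOnset.BridgeBound` (stmt-CriticalPhenomena-5109), settled: "Russo counted twice" —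
# `(1-p)·E_p[#open pivotal edges of {0 ↔ ∞}] ≤ 6p·Σ_x P_p(0 ↔ x, |C(0)| < ∞)` on `ℤ³`, every `p`

RSW3 lane (cell `prim-rsw3`, prover P2, gen 31).  Closes the support item AS FILED.  Pivotality of an edge `e`
for `A = {0 ↔ ∞}` does not depend on the state of `e`, and `P_p` is a product measure, so for every lattice
edge `(1-p)·P_p(e pivotal, e open) = p(1-p)·P_p(e pivotal) = p·P_p(e pivotal, e closed)` (non-lattice pairs
are a.s. closed); summing (Tonelli), `(1-p)·E_p[#open pivotals] = p·E_p[#closed lattice pivotals]`, and a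
closed pivotal lattice edge has an endpoint in the (then finite) cluster `C(0)`, so there are at most
`6|C(0)|·1{|C(0)| < ∞}` of them (`ℤ³` is `6`-regular), whose expectation is `6 Σ_x P_p(0 ↔ x, |C(0)| < ∞)`.
Nothing here uses p205010.
-/

noncomputable section

namespace Summit.CriticalPhenomena.PercolationContinuityZ3.Theorems.Bridges

open MeasureTheory Literature.Probability.Percolation Literature.Probability.LatticeModels
open Summit.CriticalPhenomena.PercolationContinuityZ3.Theorems.ThetaPerimeter (reachable_insert_cases)
open scoped ENNReal

variable {V : Type*}

/-! ## Pivotality: measurability, locality, factorisation -/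

/-- Pivotality of `e` for `A` is determined by the coordinates off `e`. -/
theorem determinedBy_isPivotal (A : Set (BondConfig V)) (e : Sym2 V) :
    DeterminedBy {ω : BondConfig V | IsPivotal A e ω} ({e}ᶜ : Set (Sym2 V)) := by
  rw [determinedBy_iff]
  intro ω ω' h
  have h1 : insert e ω = insert e ω' := by
    ext f
    by_cases hf : f = e
    · simp [hf]
    · have := Set.ext_iff.1 h f
      simp only [Set.mem_inter_iff, Set.mem_compl_iff, Set.mem_singleton_iff, hf, not_false_eq_true,
        and_true] at this
      simp [hf, this]
  have h2 : ω \ {e} = ω' \ {e} := by rw [Set.sdiff_eq, Set.sdiff_eq, h]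
  simp only [Set.mem_setOf_eq, IsPivotal, h1, h2]

/-- The event "`e` is pivotal for `{x ↔ ∞}`" is measurable. -/
theorem measurableSet_isPivotal [Countable V] (x : V) (e : Sym2 V) :
    MeasurableSet {ω : BondConfig V | IsPivotal (percolatesAt x) e ω} := by
  have hins : Measurable fun ω : BondConfig V => insert e ω := by
    refine measurable_set_iff.2 fun y => ?_
    simp only [Set.mem_insert_iff]
    exact measurable_const.or (measurable_set_mem y)
  have hdel : Measurable fun ω : BondConfig V => ω \ {e} := by
    have : (fun ω : BondConfig V => ω \ {e}) = fun ω => ω ∩ {e}ᶜ := by funext ω; rw [Set.sdiff_eq]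
    rw [this]; exact measurable_inter_const _
  have hA : MeasurableSet (percolatesAt x : Set (BondConfig V)) := measurableSet_percolatesAt_holds x
  have hset : {ω : BondConfig V | IsPivotal (percolatesAt x) e ω} =
      symmDiff ((fun ω : BondConfig V => insert e ω) ⁻¹' percolatesAt x) ((fun ω : BondConfig V => ω \ {e}) ⁻¹' percolatesAt x) := by
    ext ω
    simp only [Set.mem_setOf_eq, IsPivotal, Set.mem_symmDiff, Set.mem_preimage, Xor]
  rw [hset]
  exact (hA.preimage hins).symmDiff (hA.preimage hdel)

/-- **`P_p(e pivotal, e open) = p · P_p(e pivotal)`** for a lattice edge `e` (independence of the state of `e`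
from the pivotality of `e`). -/
theorem measure_isPivotal_inter_mem [Countable V] (G : SimpleGraph V) (p : unitInterval) (x : V) {e : Sym2 V}
    (he : e ∈ G.edgeSet) :
    bondPercolation G p ({ω | IsPivotal (percolatesAt x) e ω} ∩ {ω | e ∈ ω}) =
      bondPercolation G p {ω | IsPivotal (percolatesAt x) e ω} * ENNReal.ofReal p := by
  have hdet2 : DeterminedBy {ω : BondConfig V | e ∈ ω} ({e} : Set (Sym2 V)) := by
    rw [determinedBy_iff]
    intro ω ω' h
    simp only [Set.mem_setOf_eq]
    have := Set.ext_iff.1 h e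
    simpa using this
  rw [bondPercolation_inter_of_disjoint G p (disjoint_compl_left : Disjoint ({e}ᶜ : Set (Sym2 V)) {e})
    (determinedBy_isPivotal _ e) hdet2 (measurableSet_isPivotal x e) (measurableSet_mem e),
    ← ofReal_measureReal (measure_ne_top _ {ω | e ∈ ω}), bondPercolation_cylinder G p he]

/-- **`P_p(e pivotal, e closed) = (1-p) · P_p(e pivotal)`** for a lattice edge `e`. -/
theorem measure_isPivotal_inter_notMem [Countable V] (G : SimpleGraph V) (p : unitInterval) (x : V) {e : Sym2 V}
    (he : e ∈ G.edgeSet) :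
    bondPercolation G p ({ω | IsPivotal (percolatesAt x) e ω} ∩ {ω | e ∉ ω}) =
      bondPercolation G p {ω | IsPivotal (percolatesAt x) e ω} * ENNReal.ofReal (1 - p) := by
  have hdet2 : DeterminedBy {ω : BondConfig V | e ∉ ω} ({e} : Set (Sym2 V)) := by
    rw [determinedBy_iff]
    intro ω ω' h
    simp only [Set.mem_setOf_eq]
    have := Set.ext_iff.1 h e
    simpa using this.not
  rw [bondPercolation_inter_of_disjoint G p (disjoint_compl_left : Disjoint ({e}ᶜ : Set (Sym2 V)) {e})
    (determinedBy_isPivotal _ e) hdet2 (measurableSet_isPivotal x e) (measurableSet_mem e).compl,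
    ← ofReal_measureReal (measure_ne_top _ {ω | e ∉ ω}), DCT16.real_notMem G p he]

/-! ## Closed pivotal lattice edges touch the finite cluster of the origin -/

/-- **Counting closed pivotals.**  On a configuration `ω`, the number of closed lattice edges pivotal for
`{0 ↔ ∞}` is at most `6 · #{x : 0 ↔ x} · 1{|C(0)| < ∞}`. -/
theorem tsum_closedPivotal_le (ω : BondConfig (Site 3)) :
    (∑' e : Sym2 (Site 3), ({ω' : BondConfig (Site 3) | e ∈ (zdGraph 3).edgeSet ∧
        IsPivotal (percolatesAt (0 : Site 3)) e ω' ∧ e ∉ ω'}).indicator (fun _ => (1 : ℝ≥0∞)) ω) ≤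
      6 * ∑' x : Site 3, (openConn (0 : Site 3) x \ percolatesAt (0 : Site 3)).indicator (fun _ => (1 : ℝ≥0∞)) ω := by
  classical
  by_cases hA : ω ∈ percolatesAt (0 : Site 3)
  · -- `0` percolates: no closed edge is pivotal
    have h0 : ∀ e : Sym2 (Site 3), ({ω' : BondConfig (Site 3) | e ∈ (zdGraph 3).edgeSet ∧
        IsPivotal (percolatesAt (0 : Site 3)) e ω' ∧ e ∉ ω'}).indicator (fun _ => (1 : ℝ≥0∞)) ω = 0 := by
      intro e
      rw [Set.indicator_apply_eq_zero]
      rintro ⟨-, hpiv, hcl⟩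
      exfalso
      have h1 : ω \ {e} ∈ percolatesAt (0 : Site 3) := by rwa [Set.sdiff_singleton_eq_self hcl]
      have h2 : insert e ω ∈ percolatesAt (0 : Site 3) := isUpperSet_percolatesAt 0 (Set.subset_insert e ω) hA
      rcases hpiv with ⟨-, h⟩ | ⟨-, h⟩
      · exact h h1
      · exact h h2
    simp [h0]
  · -- `C(0)` is finite: closed pivotal lattice edges touch it
    have hfin : (openCluster ω (0 : Site 3)).Finite := Set.not_infinite.1 hA
    set S : Finset (Site 3) := hfin.toFinset with hS
    have hsub : {e : Sym2 (Site 3) | e ∈ (zdGraph 3).edgeSet ∧ IsPivotal (percolatesAt (0 : Site 3)) e ω ∧ e ∉ ω} ⊆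
        ↑(Literature.Probability.LatticeModels.edgesTouching (zdGraph 3) S) := by
      rintro e ⟨he, hpiv, hcl⟩
      rw [Finset.mem_coe, Literature.Probability.LatticeModels.mem_edgesTouching_iff]
      refine ⟨he, ?_⟩
      have hins : insert e ω ∈ percolatesAt (0 : Site 3) := by
        rcases hpiv with ⟨h, -⟩ | ⟨h, -⟩
        · exact h
        · exact absurd (by rwa [Set.sdiff_singleton_eq_self hcl] at h) hA
      induction e using Sym2.ind with
      | h a b =>
        by_contra hnone
        push Not at hnone
        have ha : a ∉ openCluster ω (0 : Site 3) := fun h => hnone a (by rw [hS, Set.Finite.mem_toFinset]; exact h) (by simp)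
        have hb : b ∉ openCluster ω (0 : Site 3) := fun h => hnone b (by rw [hS, Set.Finite.mem_toFinset]; exact h) (by simp)
        have hle : openCluster (insert s(a, b) ω) (0 : Site 3) ⊆ openCluster ω 0 := by
          intro z hz
          rcases reachable_insert_cases ω 0 a b z hz with h | ⟨h, -⟩
          · exact h
          · rcases h with h | h
            · exact absurd h ha
            · exact absurd h hb
        exact (hins : (openCluster (insert s(a, b) ω) (0 : Site 3)).Infinite) (hfin.subset hle)
    have hdeg : ∀ x : Site 3, (zdGraph 3).degree x ≤ 2 * 3 := fun x => degree_zdGraph_le x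
    have hcard := card_edgesTouching_le (zdGraph 3) hdeg S
    -- the right-hand side is `6 |S|`
    have hR : (∑' x : Site 3, (openConn (0 : Site 3) x \ percolatesAt (0 : Site 3)).indicator (fun _ => (1 : ℝ≥0∞)) ω) =
        (S.card : ℝ≥0∞) := by
      have : ∀ x : Site 3, (openConn (0 : Site 3) x \ percolatesAt (0 : Site 3)).indicator (fun _ => (1 : ℝ≥0∞)) ω =
          (↑S : Set (Site 3)).indicator (fun _ => (1 : ℝ≥0∞)) x := by
        intro x
        simp only [Set.indicator_apply, Set.mem_sdiff, hA, not_false_eq_true, and_true, Finset.mem_coe, hS,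
          Set.Finite.mem_toFinset]
        rfl
      simp_rw [this]
      rw [← tsum_subtype (↑S : Set (Site 3)) (fun _ => (1 : ℝ≥0∞)), ENNReal.tsum_set_one,
        Set.encard_coe_eq_coe_finsetCard]
      simp
    -- the left-hand side is at most `|edgesTouching S|`
    have hL : (∑' e : Sym2 (Site 3), ({ω' : BondConfig (Site 3) | e ∈ (zdGraph 3).edgeSet ∧
        IsPivotal (percolatesAt (0 : Site 3)) e ω' ∧ e ∉ ω'}).indicator (fun _ => (1 : ℝ≥0∞)) ω) ≤
        ((Literature.Probability.LatticeModels.edgesTouching (zdGraph 3) S).card : ℝ≥0∞) := by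
      have h1 : ∀ e : Sym2 (Site 3), ({ω' : BondConfig (Site 3) | e ∈ (zdGraph 3).edgeSet ∧
          IsPivotal (percolatesAt (0 : Site 3)) e ω' ∧ e ∉ ω'}).indicator (fun _ => (1 : ℝ≥0∞)) ω ≤
          (↑(Literature.Probability.LatticeModels.edgesTouching (zdGraph 3) S) : Set (Sym2 (Site 3))).indicator (fun _ => (1 : ℝ≥0∞)) e := by
        intro e
        by_cases h : ω ∈ {ω' : BondConfig (Site 3) | e ∈ (zdGraph 3).edgeSet ∧ IsPivotal (percolatesAt (0 : Site 3)) e ω' ∧ e ∉ ω'}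
        · rw [Set.indicator_of_mem h, Set.indicator_of_mem (hsub h)]
        · rw [Set.indicator_of_notMem h]; exact zero_le
      refine (ENNReal.tsum_le_tsum h1).trans (le_of_eq ?_)
      rw [← tsum_subtype (↑(Literature.Probability.LatticeModels.edgesTouching (zdGraph 3) S) : Set (Sym2 (Site 3)))
        (fun _ => (1 : ℝ≥0∞)), ENNReal.tsum_set_one, Set.encard_coe_eq_coe_finsetCard]
      simp
    rw [hR]
    refine hL.trans ?_
    exact_mod_cast hcard

/-! ## The item -/

/-- **`PercAntiMeanFieldOnset.BridgeBound` (stmt-CriticalPhenomena-5109), settled.** -/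
theorem bridgeBound_proof :
    Summit.CriticalPhenomena.PercolationContinuityZ3.Theses.PercAntiMeanFieldOnset.BridgeBound := by
  classical
  intro p
  set μ := bondPercolation (zdGraph 3) p with hμ
  set A : Set (BondConfig (Site 3)) := percolatesAt (0 : Site 3) with hAdef
  set E : Set (Sym2 (Site 3)) := (zdGraph 3).edgeSet with hE
  -- (i) `N_open(ω) = Σ'_e 1[e pivotal, e open]`
  have hN : ∀ ω : BondConfig (Site 3), ((pivotals A ω ∩ ω).encard : ℝ≥0∞) =
      ∑' e : Sym2 (Site 3), ({ω' : BondConfig (Site 3) | IsPivotal A e ω'} ∩ {ω' | e ∈ ω'}).indicator (fun _ => (1 : ℝ≥0∞)) ω := by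
    intro ω
    rw [← ENNReal.tsum_set_one, tsum_subtype (pivotals A ω ∩ ω) (fun _ : Sym2 (Site 3) => (1 : ℝ≥0∞))]
    refine tsum_congr fun e => ?_
    simp only [Set.indicator, Set.mem_inter_iff, mem_pivotals, Set.mem_setOf_eq]
  have hmeasO : ∀ e : Sym2 (Site 3), MeasurableSet ({ω' : BondConfig (Site 3) | IsPivotal A e ω'} ∩ {ω' | e ∈ ω'}) :=
    fun e => (measurableSet_isPivotal (0 : Site 3) e).inter (measurableSet_mem e)
  -- (ii) Tonelli
  have hI : ∫⁻ ω, ((pivotals A ω ∩ ω).encard : ℝ≥0∞) ∂μ =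
      ∑' e : Sym2 (Site 3), μ ({ω' : BondConfig (Site 3) | IsPivotal A e ω'} ∩ {ω' | e ∈ ω'}) := by
    simp_rw [hN]
    rw [lintegral_tsum fun e => (measurable_const.indicator (hmeasO e)).aemeasurable]
    refine tsum_congr fun e => ?_
    rw [lintegral_indicator_const (hmeasO e), one_mul]
  -- (iii) per edge: lattice edges factorise, non-lattice pairs are a.s. closed
  have hnull : ∀ e : Sym2 (Site 3), e ∉ E → μ ({ω' : BondConfig (Site 3) | IsPivotal A e ω'} ∩ {ω' | e ∈ ω'}) = 0 := by
    intro e he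
    refine measure_mono_null Set.inter_subset_right ?_
    have hae := ae_subset_edgeSet (zdGraph 3) p
    rw [Filter.Eventually, mem_ae_iff] at hae
    refine measure_mono_null (fun ω (hω : e ∈ ω) => ?_) hae
    exact fun hsub => he (hsub hω)
  have hterm : ∀ e : Sym2 (Site 3), μ ({ω' : BondConfig (Site 3) | IsPivotal A e ω'} ∩ {ω' | e ∈ ω'}) =
      E.indicator (fun e => μ {ω' : BondConfig (Site 3) | IsPivotal A e ω'} * ENNReal.ofReal p) e := by
    intro e
    by_cases he : e ∈ E
    · rw [Set.indicator_of_mem he]; exact measure_isPivotal_inter_mem (zdGraph 3) p 0 he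
    · rw [Set.indicator_of_notMem he]; exact hnull e he
  have hterm' : ∀ e : Sym2 (Site 3), E.indicator (fun e => μ {ω' : BondConfig (Site 3) | IsPivotal A e ω'} * ENNReal.ofReal (1 - p)) e =
      μ {ω' : BondConfig (Site 3) | e ∈ E ∧ IsPivotal A e ω' ∧ e ∉ ω'} := by
    intro e
    by_cases he : e ∈ E
    · rw [Set.indicator_of_mem he, ← measure_isPivotal_inter_notMem (zdGraph 3) p 0 he]
      congr 1; ext ω; simp [he, hAdef]
    · rw [Set.indicator_of_notMem he]
      have : {ω' : BondConfig (Site 3) | e ∈ E ∧ IsPivotal A e ω' ∧ e ∉ ω'} = ∅ := by ext ω; simp [he]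
      rw [this, measure_empty]
  have hmeasC : ∀ e : Sym2 (Site 3), MeasurableSet {ω' : BondConfig (Site 3) | e ∈ E ∧ IsPivotal A e ω' ∧ e ∉ ω'} := by
    intro e
    by_cases he : e ∈ E
    · have : {ω' : BondConfig (Site 3) | e ∈ E ∧ IsPivotal A e ω' ∧ e ∉ ω'} =
          {ω' : BondConfig (Site 3) | IsPivotal A e ω'} ∩ {ω' | e ∉ ω'} := by ext ω; simp [he]
      rw [this]; exact (measurableSet_isPivotal (0 : Site 3) e).inter (measurableSet_mem e).compl
    · have : {ω' : BondConfig (Site 3) | e ∈ E ∧ IsPivotal A e ω' ∧ e ∉ ω'} = ∅ := by ext ω; simp [he]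
      rw [this]; exact MeasurableSet.empty
  have hmeasD : ∀ x : Site 3, MeasurableSet (openConn (0 : Site 3) x \ A) :=
    fun x => (measurableSet_openConn_holds (0 : Site 3) x).diff (measurableSet_percolatesAt_holds 0)
  -- (iv) assemble
  calc ENNReal.ofReal (1 - (p : ℝ)) * ∫⁻ ω, ((pivotals A ω ∩ ω).encard : ℝ≥0∞) ∂μ
      = ENNReal.ofReal (1 - (p : ℝ)) * ∑' e : Sym2 (Site 3),
          E.indicator (fun e => μ {ω' : BondConfig (Site 3) | IsPivotal A e ω'} * ENNReal.ofReal p) e := by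
        rw [hI]; simp_rw [hterm]
    _ = ENNReal.ofReal (p : ℝ) * ∑' e : Sym2 (Site 3),
          E.indicator (fun e => μ {ω' : BondConfig (Site 3) | IsPivotal A e ω'} * ENNReal.ofReal (1 - p)) e := by
        rw [← ENNReal.tsum_mul_left, ← ENNReal.tsum_mul_left]
        refine tsum_congr fun e => ?_
        by_cases he : e ∈ E
        · simp only [Set.indicator_of_mem he]; ring
        · simp only [Set.indicator_of_notMem he, mul_zero]
    _ = ENNReal.ofReal (p : ℝ) * ∑' e : Sym2 (Site 3), μ {ω' : BondConfig (Site 3) | e ∈ E ∧ IsPivotal A e ω' ∧ e ∉ ω'} := by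
        simp_rw [hterm']
    _ = ENNReal.ofReal (p : ℝ) * ∫⁻ ω, ∑' e : Sym2 (Site 3),
          ({ω' : BondConfig (Site 3) | e ∈ E ∧ IsPivotal A e ω' ∧ e ∉ ω'}).indicator (fun _ => (1 : ℝ≥0∞)) ω ∂μ := by
        rw [lintegral_tsum fun e => (measurable_const.indicator (hmeasC e)).aemeasurable]
        congr 1
        refine tsum_congr fun e => ?_
        rw [lintegral_indicator_const (hmeasC e), one_mul]
    _ ≤ ENNReal.ofReal (p : ℝ) * ∫⁻ ω, 6 * ∑' x : Site 3, (openConn (0 : Site 3) x \ A).indicator (fun _ => (1 : ℝ≥0∞)) ω ∂μ := by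
        gcongr with ω
        exact tsum_closedPivotal_le ω
    _ = 6 * ENNReal.ofReal (p : ℝ) * ∑' x : Site 3, μ (openConn (0 : Site 3) x \ A) := by
        rw [lintegral_const_mul' _ _ (by norm_num), lintegral_tsum fun x => (measurable_const.indicator (hmeasD x)).aemeasurable]
        have : ∀ x : Site 3, ∫⁻ ω, (openConn (0 : Site 3) x \ A).indicator (fun _ => (1 : ℝ≥0∞)) ω ∂μ = μ (openConn (0 : Site 3) x \ A) :=
          fun x => by rw [lintegral_indicator_const (hmeasD x), one_mul]
        simp_rw [this]
        ring

end Summit.CriticalPhenomena.PercolationContinuityZ3.Theorems.Bridges
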